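import Literature.Analysis.FluidPDE.GKPRigidityBackwardUniqueness
import Literature.Analysis.FluidPDE.NSBoundedHigherRegularityQuantProofs
import Literature.Analysis.FluidPDE.CKNUnforcedOneScaleRRS
import Literature.Analysis.FluidPDE.CKNLocalRegularityRRSPressure
import HarnessLib

/-!
# GKP Proposition 2.3: the far-field regularity at the blow-up time from ε-regularity
# ("`(u, π)` forms a suitable weak solution and is smooth at and near the time `T*` outside of
# some large compact set `K`")

Analysis/FluidPDE proof file (theorems only: no definition, no named fact, no `sorry`) in the
cone of `Literature.Analysis.FluidPDE.hasSmoothExtensionPast_of_eHomBesovNorm_bounded`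
(Gallagher–Koch–Planchon 2016, Thm. 1) along GKP's own proof line, continuing
`GKPRigidityBackwardUniqueness.lean` (Step D of the proof of Prop. 2.3) and
`GKPRigidityBoundedClass.lean`. It supplies the **input of Step D** — the far-field derivative
bounds near the final time — from the smallness that Prop. 2.8 produces, exactly as in the
printed proof (arXiv:1407.4156, §2.5, p. 9):

> "As we now have `(u, π) ∈ L³_loc × L^{3/2}_loc` with the above spatial decay of the local
> norms [`‖u‖_{L³(Q_{ε,R}(x))} + ‖π‖_{L^{3/2}(Q_{ε,R}(x))} → 0` as `|x| → ∞`], we can conclude as in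
> [KK] … that `(u, π)` forms a suitable weak solution and is smooth at and near the time `T*`
> outside of some large compact set `K ⊂ ℝ³`."

The mechanism is ε-regularity on backward unit cylinders touching the top time
(Caffarelli–Kohn–Nirenberg 1982, Prop. 1; here Robinson–Rodrigo–Sadowski 2016, Thm. 15.3,
**proved** in the tree: `RRS2016.theorem15_3_holds`, consumed through the accepted one-scale
shape `unforced_epsilonRegularity_of_theorem15_3`), followed by the higher interior regularity of
bounded distributional solutions with the dependence of the norms on the data (Serrin 1962 /
Seregin–Šverák 2009, §2, the named fact `NSBoundedHigherRegularityBounds`, **proved** in the tree: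
`NSBoundedHigherRegularityBounds_holds`), glued along the far field by the accepted
`exists_smooth_representative_of_locally_bounded`. The output is literally the list of hypotheses
of `farField_curl_eq_zero_of_frame` (`GKPRigidityBackwardUniqueness.lean`).

Main results (viscosity `1`, as in the ε-regularity theory of the tree; other viscosities by the
Navier–Stokes rescaling):

* `exists_farField_representative_of_small_top` — there is an absolute `ε₁ > 0` such that: if on
  every backward unit cylinder `Q₁(T, x₀) = (T - 1, T) × B(x₀, 1)` with `|x₀| > R₀` the pair
  `(u, p)` satisfies the standing hypotheses of the ε-regularity theory (Lemarié-Rieusset's §14.3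
  classes, `IsLRSuitableWeakSolutionOn`, any weak gradient) with
  `∫∫_{Q₁(T,x₀)} (|u|³ + |p|^{3/2}) ≤ ε₁³`, and `(u, p)` solves the equations in `𝒟'` of the
  far-field region `Ω = (T - 1/8, T) × {|x| > R₀ + 1}`, then `u` has a representative `U` on `Ω`
  with `C^∞` slices, jointly continuous spatial derivatives, `‖D_xⁿU‖ ≤ K` on `Ω` for `n ≤ 3`,
  and `(U, p)` solves the equations in `𝒟'(Ω)`.
* `exists_farField_representative_curl_eq_zero_of_small_top` — with, in addition, slices
  tending weakly to zero as `t ↑ T`, the vorticity of `U` vanishes on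
  `(T - 1/8, T) × {|x| > R₀ + 2}` (`farField_curl_eq_zero_of_frame`, `√(1/8) ≤ 1`).
* `IsClassicalNSSolutionOn.exists_eps_eq_zero_of_small_top_of_tendsto` — **GKP Prop. 2.3,
  Steps C–E from the far-field smallness**, for a classical solution on `(0, T)` (`ν = 1`) whose
  slices are bounded realised Besov distributions: far-field ε-smallness near `T` and `u(t) → 0`
  weakly imply `u(t, ·) ≡ 0` for every `t ∈ (T - 1/8, T)` (the transfer of the derivative
  bounds from the representative to the smooth `u` is
  `iteratedFDeriv_slice_eq_of_ae_eq_of_continuousOn`).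

## References

* I. Gallagher, G. S. Koch, F. Planchon, CMP 343 (2016) = arXiv:1407.4156, §2.5 (p. 9).
  [GKP2016]
* L. Caffarelli, R. Kohn, L. Nirenberg, Comm. Pure Appl. Math. 35 (1982) 771–831, Prop. 1 and
  Cor. 1. [CaffarelliKohnNirenberg1982]
* J. C. Robinson, J. L. Rodrigo, W. Sadowski, *The Three-Dimensional Navier–Stokes Equations*,
  CUP 2016, Thm. 15.3, Thm. 13.7. [RobinsonRodrigoSadowski2016]
* G. Seregin, V. Šverák, Comm. PDE 34 (2009) = arXiv:0804.1803, §2 p. 8. [SereginSverak2009]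
* C. E. Kenig, G. S. Koch, Ann. IHP (C) 28 (2011) 159–187, §3. [KenigKoch2011]
-/

noncomputable section

open MeasureTheory TopologicalSpace Set Function Filter Metric
open _root_.Topology
open scoped ENNReal NNReal InnerProductSpace RealInnerProductSpace SchwartzMap

namespace Literature.Analysis.FluidPDE

/-! ### The far-field representative from ε-regularity and higher regularity -/

set_option maxHeartbeats 800000 in
/-- **Far-field regularity at the top time from ε-smallness** (GKP 2016, §2.5: "`(u, π)` forms a
suitable weak solution and is smooth at and near the time `T*` outside of some large compact
set `K`"; Caffarelli–Kohn–Nirenberg 1982, Prop. 1 / Robinson–Rodrigo–Sadowski 2016, Thm. 15.3 on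
the backward unit cylinders at the top time, then Serrin's higher regularity with uniform
constants, Seregin–Šverák 2009, §2). There is an absolute `ε₁ > 0` such that for all `T`, `R₀`
and every pair `(u, p)` (viscosity `1`, no force): if for every centre `x₀` with `|x₀| > R₀`
there is a weak gradient `G` with `IsLRSuitableWeakSolutionOn (Q₁(T, x₀)) 1 3 0 u p G`
(Lemarié-Rieusset's §14.3 classes on the backward unit cylinder touching the top time) and
`∫∫_{Q₁(T,x₀)} (|u|³ + |p|^{3/2}) ≤ ε₁³`, and if `(u, p)` solves the equations in the sense of
distributions on `Ω = (T - 1/8, T) × {|x| > R₀ + 1}`, then there are `K` and a field `U` with: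
`U = u` a.e. on `Ω`; `U` jointly continuous on `Ω` with `C^∞` slices at its points; all
`(t, x) ↦ D_xⁿU(t, x)` jointly continuous on `Ω`; `‖D_xⁿU‖ ≤ K` on `Ω` for `n ≤ 3`; and `(U, p)`
solves the equations in `𝒟'(Ω)`. Proof: ε-regularity (`unforced_epsilonRegularity_of_theorem15_3`
with `RRS2016.theorem15_3_holds`, `r₀ = 1`, `λ = ε₁`) bounds `|u| ≤ C₀ε₁` a.e. on every
`Q_{1/2}(T, x₀)`; every point `(t, x) ∈ Ω` has the cylinder `Q_{1/4}((min(t + 1/64, T), x))`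
inside `Q_{1/2}(T, x)`, on which the equations hold, `|u| ≤ C₀ε₁` a.e. and
`∫∫ |p|^{3/2} ≤ ε₁³`; the gluing `exists_smooth_representative_of_locally_bounded` with
`NSBoundedHigherRegularityBounds_holds` gives `U`. [cite: GKP2016, §2.5 (proof of Prop. 2.3)] [cite: CaffarelliKohnNirenberg1982, Prop. 1] [cite: SereginSverak2009, §2 p. 8] -/
theorem exists_farField_representative_of_small_top :
    ∃ ε₁ : ℝ, 0 < ε₁ ∧ ∀ (T R₀ : ℝ)
      (u : ℝ → EuclideanSpace ℝ (Fin 3) → EuclideanSpace ℝ (Fin 3))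
      (p : ℝ → EuclideanSpace ℝ (Fin 3) → ℝ),
      (∀ x₀ : EuclideanSpace ℝ (Fin 3), R₀ < ‖x₀‖ →
        (∃ G : ℝ → EuclideanSpace ℝ (Fin 3) →
            EuclideanSpace ℝ (Fin 3) →L[ℝ] EuclideanSpace ℝ (Fin 3),
          IsLRSuitableWeakSolutionOn (parabolicCylinderOpens 1 ((T, x₀) : ℝ × EuclideanSpace ℝ (Fin 3)))
            1 3 0 u p G) ∧
        ∫⁻ w in parabolicCylinder 1 ((T, x₀) : ℝ × EuclideanSpace ℝ (Fin 3)),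
            (‖u w.1 w.2‖ₑ ^ (3 : ℕ) + ‖p w.1 w.2‖ₑ ^ (3 / 2 : ℝ)) ≤ ENNReal.ofReal (ε₁ ^ 3)) →
      IsDistributionalNSSolutionOn
        ⟨Ioo (T - 1 / 8) T ×ˢ (closedBall (0 : EuclideanSpace ℝ (Fin 3)) (R₀ + 1))ᶜ,
          isOpen_Ioo.prod isClosed_closedBall.isOpen_compl⟩ 1 0 u p →
      ∃ (K : ℝ) (U : ℝ → EuclideanSpace ℝ (Fin 3) → EuclideanSpace ℝ (Fin 3)),
        uncurry U =ᵐ[volume.restrict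
          (Ioo (T - 1 / 8) T ×ˢ (closedBall (0 : EuclideanSpace ℝ (Fin 3)) (R₀ + 1))ᶜ)] uncurry u ∧
        ContinuousOn (uncurry U)
          (Ioo (T - 1 / 8) T ×ˢ (closedBall (0 : EuclideanSpace ℝ (Fin 3)) (R₀ + 1))ᶜ) ∧
        (∀ w ∈ Ioo (T - 1 / 8) T ×ˢ (closedBall (0 : EuclideanSpace ℝ (Fin 3)) (R₀ + 1))ᶜ,
          ContDiffAt ℝ (⊤ : ℕ∞) (U w.1) w.2) ∧
        (∀ n : ℕ, ContinuousOn
          (fun w : ℝ × EuclideanSpace ℝ (Fin 3) => iteratedFDeriv ℝ n (U w.1) w.2)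
          (Ioo (T - 1 / 8) T ×ˢ (closedBall (0 : EuclideanSpace ℝ (Fin 3)) (R₀ + 1))ᶜ)) ∧
        (∀ n ≤ 3, ∀ w ∈ Ioo (T - 1 / 8) T ×ˢ (closedBall (0 : EuclideanSpace ℝ (Fin 3)) (R₀ + 1))ᶜ,
          ‖iteratedFDeriv ℝ n (U w.1) w.2‖ ≤ K) ∧
        IsDistributionalNSSolutionOn
          ⟨Ioo (T - 1 / 8) T ×ˢ (closedBall (0 : EuclideanSpace ℝ (Fin 3)) (R₀ + 1))ᶜ,
            isOpen_Ioo.prod isClosed_closedBall.isOpen_compl⟩ 1 0 U p := by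
  obtain ⟨ε₀, C₀, hε₀, hC₀, H⟩ := unforced_epsilonRegularity_of_theorem15_3 RRS2016.theorem15_3_holds
  refine ⟨ε₀, hε₀, fun T R₀ u p hfar hsol => ?_⟩
  set S : Set (EuclideanSpace ℝ (Fin 3)) := (closedBall (0 : EuclideanSpace ℝ (Fin 3)) (R₀ + 1))ᶜ
    with hSdef
  have hSo : IsOpen S := isClosed_closedBall.isOpen_compl
  set Ω : Set (ℝ × EuclideanSpace ℝ (Fin 3)) := Ioo (T - 1 / 8) T ×ˢ S with hΩdef
  have hΩo : IsOpen Ω := isOpen_Ioo.prod hSo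
  -- ### ε-regularity on the unit cylinders at the top: `|u| ≤ C₀ ε₀` a.e. on `Q_{1/2}(T, x₀)`
  have hbd : ∀ x₀ : EuclideanSpace ℝ (Fin 3), R₀ < ‖x₀‖ →
      ∀ᵐ w ∂(volume.restrict (parabolicCylinder (1 / 2) ((T, x₀) : ℝ × EuclideanSpace ℝ (Fin 3)))),
        ‖u w.1 w.2‖ ≤ C₀ * ε₀ := by
    intro x₀ hx₀
    obtain ⟨⟨G, hG⟩, hsmall⟩ := hfar x₀ hx₀
    have h := H (parabolicCylinderOpens 1 ((T, x₀) : ℝ × EuclideanSpace ℝ (Fin 3))) 3 u p G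
      (by norm_num) hG (T, x₀) 1 ε₀ one_pos Subset.rfl hε₀.le le_rfl
      (by rw [one_pow, mul_one]; exact hsmall)
    rw [div_one] at h
    exact h
  -- ### the local data of the gluing: cylinders `Q_{1/4}((min (t + 1/64) T, x))`
  have hρ : (0 : ℝ) < 1 / 8 := by norm_num
  have hloc : ∀ z ∈ Ioo (T - 1 / 8) T ×ˢ S,
      IsDistributionalNSSolutionOn
          (parabolicCylinderOpens (2 * (1 / 8)) (min (z.1 + (1 / 8) ^ 2) T, z.2)) 1 0 u p ∧
        (∀ᵐ q ∂(volume.restrict (parabolicCylinder (2 * (1 / 8)) (min (z.1 + (1 / 8) ^ 2) T, z.2))),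
          ‖u q.1 q.2‖ ≤ C₀ * ε₀) ∧
        ∫⁻ q in parabolicCylinder (2 * (1 / 8)) (min (z.1 + (1 / 8) ^ 2) T, z.2),
          ‖p q.1 q.2‖ₑ ^ (3 / 2 : ℝ) ≤ (ε₀ ^ 3).toNNReal := by
    rintro ⟨t, x⟩ ⟨ht, hx⟩
    have hxR : R₀ < ‖x‖ := by
      rw [hSdef, mem_compl_iff, mem_closedBall, dist_zero_right, not_le] at hx
      linarith
    -- the small cylinder lies in `Q_{1/2}(T, x)`, which lies in `Q₁(T, x)`
    have hsub₂ : parabolicCylinder (2 * (1 / 8)) ((min (t + (1 / 8) ^ 2) T, x) : ℝ × EuclideanSpace ℝ (Fin 3)) ⊆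
        parabolicCylinder (1 / 2) ((T, x) : ℝ × EuclideanSpace ℝ (Fin 3)) := by
      intro w hw
      rw [mem_parabolicCylinder] at hw ⊢
      obtain ⟨⟨hw1, hw2⟩, hw3⟩ := hw
      have hmin1 : min (t + (1 / 8) ^ 2) T ≤ T := min_le_right _ _
      have hmin2 : t ≤ min (t + (1 / 8) ^ 2) T := le_min (by norm_num) ht.2.le
      refine ⟨⟨?_, ?_⟩, ?_⟩
      · simp only at hw1 ⊢
        nlinarith [ht.1]
      · simp only at hw2 ⊢
        linarith
      · simp only at hw3 ⊢
        linarith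
    have hsub₁ : parabolicCylinder (1 / 2) ((T, x) : ℝ × EuclideanSpace ℝ (Fin 3)) ⊆
        parabolicCylinder 1 ((T, x) : ℝ × EuclideanSpace ℝ (Fin 3)) := by
      intro w hw
      rw [mem_parabolicCylinder] at hw ⊢
      obtain ⟨⟨hw1, hw2⟩, hw3⟩ := hw
      exact ⟨⟨by simp only at hw1 ⊢; linarith, hw2⟩, by linarith⟩
    obtain ⟨⟨G, hG⟩, hsmall⟩ := hfar x hxR
    refine ⟨?_, ?_, ?_⟩
    · -- the equations on the small cylinder
      exact hG.distributional.of_le fun w hw => hsub₁ (hsub₂ hw)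
    · -- the bound
      exact ae_restrict_of_ae_restrict_of_subset hsub₂ (hbd x hxR)
    · -- the pressure
      calc ∫⁻ q in parabolicCylinder (2 * (1 / 8)) ((min (t + (1 / 8) ^ 2) T, x) : ℝ × EuclideanSpace ℝ (Fin 3)),
            ‖p q.1 q.2‖ₑ ^ (3 / 2 : ℝ)
          ≤ ∫⁻ q in parabolicCylinder 1 ((T, x) : ℝ × EuclideanSpace ℝ (Fin 3)),
              ‖p q.1 q.2‖ₑ ^ (3 / 2 : ℝ) := lintegral_mono_set fun w hw => hsub₁ (hsub₂ hw)
        _ ≤ ∫⁻ q in parabolicCylinder 1 ((T, x) : ℝ × EuclideanSpace ℝ (Fin 3)),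
              (‖u q.1 q.2‖ₑ ^ (3 : ℕ) + ‖p q.1 q.2‖ₑ ^ (3 / 2 : ℝ)) :=
            lintegral_mono fun q => le_add_self
        _ ≤ ENNReal.ofReal (ε₀ ^ 3) := hsmall
        _ = ((ε₀ ^ 3).toNNReal : ℝ≥0∞) := rfl
  -- ### the gluing
  obtain ⟨K, U, hae, hUc, hCD, hjc, hbdK⟩ :=
    exists_smooth_representative_of_locally_bounded NSBoundedHigherRegularityBounds_holds hSo hρ
      hloc 3
  refine ⟨K, U, hae, hUc, hCD, hjc, hbdK, ?_⟩
  exact hsol.congr_ae ((ae_restrict_iff' hΩo.measurableSet).2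
    ((ae_restrict_iff' hΩo.measurableSet).1 hae.symm)) (ae_of_all _ fun _ => rfl)


/-! ### The far-field vorticity vanishes -/

/-- `√(1/8) ≤ 1`, in the form used to shrink the far-field region. [folklore] -/
theorem sqrt_one_mul_sub_sub_le_one (T : ℝ) : Real.sqrt (1 * (T - (T - 1 / 8))) ≤ 1 := by
  rw [one_mul, sub_sub_cancel, Real.sqrt_le_one]
  norm_num

/-- **The far-field vorticity vanishes near the top time, from ε-smallness and weak vanishing of
the slices** (GKP 2016, §2.5: ε-regularity outside a compact set, "`NS(u₀)(x, T*) ≡ 0` for all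
`x ∈ Kᶜ`", and backward uniqueness; ESS 2003, §3 (3.31)–(3.32)). With `ε₁` from
`exists_farField_representative_of_small_top`: if `(u, p)` (viscosity `1`) satisfies the §14.3
classes with `∫∫ (|u|³ + |p|^{3/2}) ≤ ε₁³` on every backward unit cylinder `Q₁(T, x₀)`,
`|x₀| > R₀ ≥ 0`, solves the equations in `𝒟'((T - 1/8, T) × {|x| > R₀ + 1})`, and its slices
tend to zero weakly as `t ↑ T`, then the far-field representative `U` has
`∇ ∧ U(t, ·) = 0` on `{|x| > R₀ + 2}` for every `t ∈ (T - 1/8, T)`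
(`farField_curl_eq_zero_of_frame`, `√(1/8) ≤ 1`). [cite: GKP2016, §2.5 (proof of Prop. 2.3)] [cite: EscauriazaSereginSverak2003, §3 (3.31)-(3.32) and Thm. 5.1] -/
theorem exists_farField_representative_curl_eq_zero_of_small_top :
    ∃ ε₁ : ℝ, 0 < ε₁ ∧ ∀ (T R₀ : ℝ), 0 ≤ R₀ →
      ∀ (u : ℝ → EuclideanSpace ℝ (Fin 3) → EuclideanSpace ℝ (Fin 3))
        (p : ℝ → EuclideanSpace ℝ (Fin 3) → ℝ),
      (∀ x₀ : EuclideanSpace ℝ (Fin 3), R₀ < ‖x₀‖ →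
        (∃ G : ℝ → EuclideanSpace ℝ (Fin 3) →
            EuclideanSpace ℝ (Fin 3) →L[ℝ] EuclideanSpace ℝ (Fin 3),
          IsLRSuitableWeakSolutionOn (parabolicCylinderOpens 1 ((T, x₀) : ℝ × EuclideanSpace ℝ (Fin 3)))
            1 3 0 u p G) ∧
        ∫⁻ w in parabolicCylinder 1 ((T, x₀) : ℝ × EuclideanSpace ℝ (Fin 3)),
            (‖u w.1 w.2‖ₑ ^ (3 : ℕ) + ‖p w.1 w.2‖ₑ ^ (3 / 2 : ℝ)) ≤ ENNReal.ofReal (ε₁ ^ 3)) →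
      IsDistributionalNSSolutionOn
        ⟨Ioo (T - 1 / 8) T ×ˢ (closedBall (0 : EuclideanSpace ℝ (Fin 3)) (R₀ + 1))ᶜ,
          isOpen_Ioo.prod isClosed_closedBall.isOpen_compl⟩ 1 0 u p →
      (∀ φ : EuclideanSpace ℝ (Fin 3) → EuclideanSpace ℝ (Fin 3),
        FunctionSpaces.IsTestFunctionOn (⊤ : Opens (EuclideanSpace ℝ (Fin 3))) φ →
          Tendsto (fun t => ∫ x, ⟪u t x, φ x⟫) (𝓝[<] T) (𝓝 0)) →
      ∃ (K : ℝ) (U : ℝ → EuclideanSpace ℝ (Fin 3) → EuclideanSpace ℝ (Fin 3)),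
        uncurry U =ᵐ[volume.restrict
          (Ioo (T - 1 / 8) T ×ˢ (closedBall (0 : EuclideanSpace ℝ (Fin 3)) (R₀ + 1))ᶜ)] uncurry u ∧
        ContinuousOn (uncurry U)
          (Ioo (T - 1 / 8) T ×ˢ (closedBall (0 : EuclideanSpace ℝ (Fin 3)) (R₀ + 1))ᶜ) ∧
        (∀ w ∈ Ioo (T - 1 / 8) T ×ˢ (closedBall (0 : EuclideanSpace ℝ (Fin 3)) (R₀ + 1))ᶜ,
          ContDiffAt ℝ (⊤ : ℕ∞) (U w.1) w.2) ∧
        (∀ n ≤ 3, ∀ w ∈ Ioo (T - 1 / 8) T ×ˢ (closedBall (0 : EuclideanSpace ℝ (Fin 3)) (R₀ + 1))ᶜ,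
          ‖iteratedFDeriv ℝ n (U w.1) w.2‖ ≤ K) ∧
        ∀ t ∈ Ioo (T - 1 / 8) T, ∀ x : EuclideanSpace ℝ (Fin 3), R₀ + 2 < ‖x‖ →
          curl (U t) x = 0 := by
  obtain ⟨ε₁, hε₁, H⟩ := exists_farField_representative_of_small_top
  refine ⟨ε₁, hε₁, fun T R₀ hR₀ u p hfar hsol hfinal => ?_⟩
  obtain ⟨K, U, hae, hUc, hCD, hjc, hbdK, hsolU⟩ := H T R₀ u p hfar hsol
  have hT₄ : T - 1 / 8 < T := by linarith
  have hR : 0 ≤ R₀ + 1 := by linarith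
  have hcurl := farField_curl_eq_zero_of_frame one_pos hT₄ hR hfinal hae hsolU hCD
    (fun n _ => hjc n) hbdK
  refine ⟨K, U, hae, hUc, hCD, hbdK, fun t ht x hx => hcurl t ht x ?_⟩
  linarith [sqrt_one_mul_sub_sub_le_one T]

/-! ### GKP Prop. 2.3, Steps C–E from the far-field smallness, for classical solutions -/

/-- **Spatial derivatives of a smooth field agree with those of a representative which it equals
on an open set.** If `u` is jointly smooth on the strip `S × ℝ³` (`IsSmoothSpaceTimeOn`),
`U` is jointly continuous on an open `Ω ⊆ S × ℝ³` with all `D_xⁿU` jointly continuous there, and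
`U = u` a.e. on `Ω`, then `D_xⁿu = D_xⁿU` at every point of `Ω` (continuous representatives of
one class agree on the open set; the iterated derivative only sees the germ of the slice).
[folklore] -/
theorem iteratedFDeriv_slice_eq_of_ae_eq_of_continuousOn {S : Set ℝ}
    {u U : ℝ → EuclideanSpace ℝ (Fin 3) → EuclideanSpace ℝ (Fin 3)} (hu : IsSmoothSpaceTimeOn S u)
    {Ω : Set (ℝ × EuclideanSpace ℝ (Fin 3))} (hΩo : IsOpen Ω) (hΩS : Ω ⊆ S ×ˢ univ)
    (hUc : ContinuousOn (uncurry U) Ω) (hae : uncurry U =ᵐ[volume.restrict Ω] uncurry u)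
    (n : ℕ) {w : ℝ × EuclideanSpace ℝ (Fin 3)} (hw : w ∈ Ω) :
    iteratedFDeriv ℝ n (u w.1) w.2 = iteratedFDeriv ℝ n (U w.1) w.2 := by
  have heq : EqOn (uncurry U) (uncurry u) Ω :=
    Measure.eqOn_open_of_ae_eq hae hΩo hUc (hu.continuousOn.mono hΩS)
  -- the slice of `Ω` at `w.1` is an open neighbourhood of `w.2` on which the slices agree
  have hslice : IsOpen {x : EuclideanSpace ℝ (Fin 3) | (w.1, x) ∈ Ω} :=
    hΩo.preimage (Continuous.prodMk_right w.1)
  have hev : (u w.1) =ᶠ[𝓝 w.2] (U w.1) := by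
    filter_upwards [hslice.mem_nhds (show w.2 ∈ {x | (w.1, x) ∈ Ω} from hw)] with x hx
    exact (heq hx).symm
  exact (hev.iteratedFDeriv ℝ n).eq_of_nhds

/-- **GKP 2016, Prop. 2.3 — Steps C, D, E of its proof from the far-field smallness, for a
classical solution** (viscosity `1`). Let `(u, π)` be a classical solution of the unforced
Navier–Stokes equations on the open strip `(0, T)`, `T > 1/8`, whose slices `u t`,
`t ∈ (T - 1/8, T)`, are bounded realised homogeneous Besov distributions (`V t ∈ Ḃ^s_{p,q}` the
tempered distribution of `u t`; for `NS(u₀)` of GKP: Kato's class and (1.6)). Suppose, with `ε₁`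
from `exists_farField_representative_of_small_top` and some `R₀ ≥ 0`: on every backward unit
cylinder `Q₁(T, x₀)`, `|x₀| > R₀`, the pair satisfies the §14.3 classes with
`∫∫_{Q₁(T,x₀)} (|u|³ + |π|^{3/2}) ≤ ε₁³` (the smallness at spatial infinity near `T*` that
Prop. 2.8 provides, "`‖u‖_{L³(Q_{ε,R}(x))} → 0`, `‖π‖_{L^{3/2}(Q_{ε,R}(x))} → 0` as `|x| → ∞`",
together with the local energy classes of a suitable weak solution), and the slices tend to zero
weakly as `t ↑ T` ("`u(t) → 0` in `𝓢'`", `tendsto_integral_inner_of_tendsto_temperedDistribution_zero`).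
Then `u(t, ·) ≡ 0` for every `t ∈ (T - 1/8, T)`. Proof: the far-field representative of
`exists_farField_representative_of_small_top` coincides with the smooth `u` on the far-field
region, so `‖D_xⁿu‖ ≤ K` there (`n ≤ 3`), and
`IsClassicalNSSolutionOn.eq_zero_of_farField_of_tendsto` applies.
[cite: GKP2016, Prop. 2.3 and §2.5] [cite: CaffarelliKohnNirenberg1982, Prop. 1] [cite: EscauriazaSereginSverak2003, Thm. 4.1 and Thm. 5.1] -/
theorem IsClassicalNSSolutionOn.exists_eps_eq_zero_of_small_top_of_tendsto :
    ∃ ε₁ : ℝ, 0 < ε₁ ∧ ∀ (T R₀ : ℝ), 1 / 8 < T → 0 ≤ R₀ →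
      ∀ (u : ℝ → EuclideanSpace ℝ (Fin 3) → EuclideanSpace ℝ (Fin 3))
        (π : ℝ → EuclideanSpace ℝ (Fin 3) → ℝ), IsClassicalNSSolutionOn (Ioo 0 T) 1 0 u π →
      (∀ x₀ : EuclideanSpace ℝ (Fin 3), R₀ < ‖x₀‖ →
        (∃ G : ℝ → EuclideanSpace ℝ (Fin 3) →
            EuclideanSpace ℝ (Fin 3) →L[ℝ] EuclideanSpace ℝ (Fin 3),
          IsLRSuitableWeakSolutionOn (parabolicCylinderOpens 1 ((T, x₀) : ℝ × EuclideanSpace ℝ (Fin 3)))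
            1 3 0 u π G) ∧
        ∫⁻ w in parabolicCylinder 1 ((T, x₀) : ℝ × EuclideanSpace ℝ (Fin 3)),
            (‖u w.1 w.2‖ₑ ^ (3 : ℕ) + ‖π w.1 w.2‖ₑ ^ (3 / 2 : ℝ)) ≤ ENNReal.ofReal (ε₁ ^ 3)) →
      (∀ φ : EuclideanSpace ℝ (Fin 3) → EuclideanSpace ℝ (Fin 3),
        FunctionSpaces.IsTestFunctionOn (⊤ : Opens (EuclideanSpace ℝ (Fin 3))) φ →
          Tendsto (fun t => ∫ x, ⟪u t x, φ x⟫) (𝓝[<] T) (𝓝 0)) →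
      (∀ t ∈ Ioo (T - 1 / 8) T, ∃ M : ℝ, ∀ x, ‖u t x‖ ≤ M) →
      ∀ {s : ℝ} {p q : ℝ≥0∞} [Fact (1 ≤ p)]
        {V : ℝ → 𝓢'(EuclideanSpace ℝ (Fin 3), EuclideanSpace ℂ (Fin 3))},
        (∀ t ∈ Ioo (T - 1 / 8) T, IsDistributionOf (u t) (V t)) →
        (∀ t ∈ Ioo (T - 1 / 8) T, FunctionSpaces.MemHomBesov s p q (V t)) →
        ∀ t ∈ Ioo (T - 1 / 8) T, u t = 0 := by
  obtain ⟨ε₁, hε₁, H⟩ := exists_farField_representative_of_small_top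
  refine ⟨ε₁, hε₁, fun T R₀ hT hR₀ u π hcl hfar hfinal hM s p q _ V hV hB => ?_⟩
  set S : Set (EuclideanSpace ℝ (Fin 3)) := (closedBall (0 : EuclideanSpace ℝ (Fin 3)) (R₀ + 1))ᶜ
    with hSdef
  have hSo : IsOpen S := isClosed_closedBall.isOpen_compl
  set Ω : Set (ℝ × EuclideanSpace ℝ (Fin 3)) := Ioo (T - 1 / 8) T ×ˢ S with hΩdef
  have hΩo : IsOpen Ω := isOpen_Ioo.prod hSo
  have hT₄ : 0 < T - 1 / 8 := by linarith
  have hsub : Ioo (T - 1 / 8) T ⊆ Ioo 0 T := Ioo_subset_Ioo hT₄.le le_rfl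
  have hΩsub : Ω ⊆ Ioo 0 T ×ˢ univ := prod_mono hsub (subset_univ _)
  -- the classical solution is a distributional solution on the far-field region
  have hsol : IsDistributionalNSSolutionOn ⟨Ω, hΩo⟩ 1 0 u π := by
    have hw2 : ContDiffOn ℝ 2 (uncurry u) (Ioo 0 T ×ˢ univ) :=
      hcl.smooth_velocity.of_le (by norm_cast)
    have hp1 : ContDiffOn ℝ 1 (uncurry π) (Ioo 0 T ×ˢ univ) :=
      hcl.smooth_pressure.of_le (by norm_cast)
    have hf : ContinuousOn
        (uncurry (0 : ℝ → EuclideanSpace ℝ (Fin 3) → EuclideanSpace ℝ (Fin 3)))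
        (Ioo 0 T ×ˢ univ) := continuousOn_const
    refine isDistributionalNSSolutionOn_of_contDiffOn isOpen_Ioo hΩsub hw2 hp1 hf
      (fun t ht x => ?_) hcl.divFree
    have hm := hcl.momentum t ht x
    rwa [timeDerivWithin_eq_deriv isOpen_Ioo ht, ← timeDeriv_apply] at hm
  -- the far-field representative and the transfer of its bounds to `u`
  obtain ⟨K, U, hae, hUc, -, hjc, hbdK, -⟩ := H T R₀ u π hfar hsol
  have hbd : ∀ n ≤ 3, ∀ w ∈ Ioo (T - 1 / 8) T ×ˢ (closedBall (0 : EuclideanSpace ℝ (Fin 3)) (R₀ + 1))ᶜ,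
      ‖iteratedFDeriv ℝ n (u w.1) w.2‖ ≤ K := by
    intro n hn w hw
    rw [iteratedFDeriv_slice_eq_of_ae_eq_of_continuousOn hcl.smooth_velocity hΩo hΩsub hUc hae n hw]
    exact hbdK n hn w hw
  exact hcl.eq_zero_of_farField_of_tendsto one_pos hT₄ (by linarith) (by linarith) hbd hfinal hM
    hV hB

end Literature.Analysis.FluidPDE

end
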